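import Summits.ResolutionOfSingularities.ResolutionOfSingularities.Theorems.WildQuotientsSummitReductionStubPairOrbitBlowupCentreFlatLemmas4
import Literature.AlgebraicGeometry.Resolution.CompletionBaseChange
import HarnessLib

/-!
# `WildQuotients.SummitReduction` (stmt-ResolutionOfSingularities-16324), line `FramePerfect`:
# the formal model at a point of the orbit centre WITH its Cohen coordinates, and the residue facts
# of the base map (stub `stub_pair_orbitBlowupCentreLocal`, file 5)

Route `ResolutionOfSingularities/WildQuotients`, crux `SummitReduction`; helper file of stub
`stub_pair_orbitBlowupCentreLocal` (C2) of the line skeleton (v8). Stub C1's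
`centreFlat_exists_nodeDeformationRing_orbitCentre_compat` (de Jong 1996, 3.3 + 3.4 ¶2 at a point `z`
of the orbit closure, any field, quasi-split) provides the formal model
`e : 𝒪̂_{X,z} ≅ Λ⟦u, v⟧/(uv - c t²)`, `Λ = κ(f z)⟦T₁, …, T_m⟧`, over a flat `β : 𝒪_{Y,f z} → Λ`, but
hides that `β` is the Cohen-coordinate map; the transfer of the quasi-split datum to the blown-up
curve (C2, files 3–4) needs two more properties of `β` — `𝔪_{f z} Λ = 𝔪_Λ` and `𝒪_{Y,f z} → Λ/𝔪_Λ`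
onto. This file re-runs C1's proof exporting the Cohen isomorphism `eA`
(`centreLocal_exists_nodeDeformationRing_orbitCentre_cohen`) and records the two residue facts for
`β = eA ∘ (𝒪_{Y,f z} → 𝒪̂_{Y,f z})` (`map_maximalIdeal_cohen_comp_eq`, `residuallySurjective_cohen_comp`,
`flat_cohen_comp`).
-/

-- the problem path `ResolutionOfSingularities/ResolutionOfSingularities` makes the conventional
-- namespace repeat a component, which `linter.dupNamespace` flags
set_option linter.dupNamespace false

noncomputable section

open CategoryTheory CategoryTheory.Limits AlgebraicGeometry TopologicalSpace
open Literature.AlgebraicGeometry.Resolution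
open Literature.AlgebraicGeometry.Resolution.DeJong1996
open Literature.AlgebraicGeometry.Resolution.DeJong1996.NodeDeformationRing
open Literature.AlgebraicGeometry.Resolution.DeJong1996.FormalNodeRing
open Literature.AlgebraicGeometry
open Scheme.IdealSheafData IsLocalRing NodalDeformation

namespace Summit.ResolutionOfSingularities.ResolutionOfSingularities.Theorems

universe u

/-! ## The residue facts of a Cohen-coordinate base map -/

section CohenFacts

variable {A Λ : Type u} [CommRing A] [IsLocalRing A] [IsNoetherianRing A] [CommRing Λ] [IsLocalRing Λ]
  (eA : AdicCompletion (maximalIdeal A) A ≃+* Λ)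

/-- For `β = eA ∘ (A → Â)` with `eA : Â ≅ Λ`: **`𝔪_A Λ = 𝔪_Λ`** (`𝔪_A Â` is the maximal ideal of `Â`).
[folklore] -/
theorem map_maximalIdeal_cohen_comp_eq :
    (maximalIdeal A).map (eA.toRingHom.comp (algebraMap A (AdicCompletion (maximalIdeal A) A))) =
      maximalIdeal Λ := by
  have hfg : (maximalIdeal A).FG := (isNoetherianRing_iff_ideal_fg A).mp inferInstance _
  haveI : ((maximalIdeal A).map (algebraMap A (AdicCompletion (maximalIdeal A) A))).IsMaximal :=
    AdicCompletion.isMaximal_map_of_le _ _ le_rfl hfg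
  rw [← Ideal.map_map]
  exact IsLocalRing.eq_maximalIdeal (Ideal.map_isMaximal_of_equiv eA)

/-- For `β = eA ∘ (A → Â)`: **`A → Λ/𝔪_Λ` is onto** (`A/𝔪_A = Â/𝔪_A Â`). [folklore] -/
theorem residuallySurjective_cohen_comp :
    Function.Surjective ((Ideal.Quotient.mk (maximalIdeal Λ)).comp
      (eA.toRingHom.comp (algebraMap A (AdicCompletion (maximalIdeal A) A)))) := by
  have hfg : (maximalIdeal A).FG := (isNoetherianRing_iff_ideal_fg A).mp inferInstance _
  intro z
  obtain ⟨l, rfl⟩ := Ideal.Quotient.mk_surjective z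
  obtain ⟨â, rfl⟩ := eA.surjective l
  -- level one of `A → Â` is onto
  have h1 := (quotientMap_pow_bijective_adicCompletion (maximalIdeal A) hfg 1).2
  obtain ⟨ā, hā⟩ := h1 (Ideal.Quotient.mk _ â)
  obtain ⟨a, rfl⟩ := Ideal.Quotient.mk_surjective ā
  refine ⟨a, ?_⟩
  rw [Ideal.quotientMap_mk, Ideal.Quotient.mk_eq_mk_iff_sub_mem, pow_one] at hā
  rw [RingHom.comp_apply, RingHom.comp_apply, Ideal.Quotient.mk_eq_mk_iff_sub_mem, RingEquiv.toRingHom_eq_coe,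
    RingHom.coe_coe, ← map_sub, ← map_maximalIdeal_cohen_comp_eq eA, ← Ideal.map_map]
  exact Ideal.mem_map_of_mem _ hā

omit [IsLocalRing Λ] in
/-- `β = eA ∘ (A → Â)` is flat. [folklore] -/
theorem flat_cohen_comp : (eA.toRingHom.comp (algebraMap A (AdicCompletion (maximalIdeal A) A))).Flat :=
  RingHom.Flat.comp (RingHom.flat_algebraMap_iff.mpr (AdicCompletion.flat_of_isNoetherian _))
    (RingHom.Flat.of_bijective eA.bijective)

end CohenFacts

/-! ## The formal model at a point of the orbit closure, with Cohen coordinates -/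

-- the stalk instances make a few definitional unifications slow (kabstract on `𝒪̂_{X,z}`-ideals)
set_option maxHeartbeats 800000 in
/-- **Variant of `centreFlat_exists_nodeDeformationRing_orbitCentre_compat` (stub C1) exporting the
Cohen coordinates of the base.** Same statement, with the flat base map `β` replaced by its source:
the Cohen isomorphism `eA : 𝒪̂_{Y,f z} ≅ κ(f z)⟦T₁, …, T_m⟧` (`β = eA ∘ (𝒪_{Y,f z} → 𝒪̂_{Y,f z})`), so
that `β` is seen to be residually onto with `𝔪_{f z} Λ = 𝔪_Λ` — which the quasi-split datum
upstairs (stub C2, file 4) needs. The proof is that of C1's theorem verbatim (adapted from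
`…OrbitBlowupCentreFlatLemmas4`). [cite: DeJong1996, 3.3–3.4, pp. 63–64]
[cite: DeJong1997, proof of Prop. 5.11, p. 618] -/
theorem centreLocal_exists_nodeDeformationRing_orbitCentre_cohen {k : Type} [Field k]
    {X Y : Scheme.{0}} [IsLocallyNoetherian X] [IsLocallyNoetherian Y] (q : Y ⟶ Spec (.of k))
    (hreg : Scheme.IsRegular Y) {D : Set Y} (hD : IsStrictNormalCrossingsDivisor Y D)
    (f : X ⟶ Y) [LocallyOfFiniteType (f ≫ q)] (hss : IsSemiStableCurve f)
    (hqs : (∀ x : X, (¬ ∃ U : X.Opens, x ∈ U ∧ Smooth (U.ι ≫ f)) →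
        ∃ e : AdicCompletion
            ((IsLocalRing.maximalIdeal (X.presheaf.stalk x)).map (Ideal.Quotient.mk
              ((IsLocalRing.maximalIdeal (Y.presheaf.stalk (f.base x))).map (f.stalkMap x).hom)))
            (X.presheaf.stalk x ⧸
              (IsLocalRing.maximalIdeal (Y.presheaf.stalk (f.base x))).map (f.stalkMap x).hom) ≃+*
          MvPowerSeries (Fin 2) (Y.presheaf.stalk (f.base x) ⧸ IsLocalRing.maximalIdeal (Y.presheaf.stalk (f.base x))) ⧸
            Ideal.span {(MvPowerSeries.X 0 * MvPowerSeries.X 1 :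
              MvPowerSeries (Fin 2) (Y.presheaf.stalk (f.base x) ⧸ IsLocalRing.maximalIdeal (Y.presheaf.stalk (f.base x))))},
          e.toRingHom.comp ((algebraMap (X.presheaf.stalk x ⧸
              (IsLocalRing.maximalIdeal (Y.presheaf.stalk (f.base x))).map (f.stalkMap x).hom) _).comp
            (Ideal.quotientMap ((IsLocalRing.maximalIdeal (Y.presheaf.stalk (f.base x))).map (f.stalkMap x).hom)
              (f.stalkMap x).hom Ideal.le_comap_map)) =
          algebraMap (Y.presheaf.stalk (f.base x) ⧸ IsLocalRing.maximalIdeal (Y.presheaf.stalk (f.base x))) _))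
    (hsm : Smooth (f ∣_ ⟨Dᶜ, hD.isClosed.isOpen_compl⟩))
    {G : Type} [Group G] [Finite G] (ρX : G →* Aut X) {x : X}
    (hx : x ∈ Scheme.singularLocusCodimLE X 2) {z : X}
    (hz : z ∈ closure (Set.range fun g : G => (ρX g).hom.base x)) :
    ∃ (m : ℕ) (c t : MvPowerSeries (Fin m) (ResidueField (Y.presheaf.stalk (f.base z))))
      (_ : t ≠ 0)
      (e : Cpl (X.presheaf.stalk z) ≃+*
        NodeDeformationRing (MvPowerSeries (Fin m) (ResidueField (Y.presheaf.stalk (f.base z))))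
          (c * t ^ 2))
      (eA : Cpl (Y.presheaf.stalk (f.base z)) ≃+* MvPowerSeries (Fin m) (ResidueField (Y.presheaf.stalk (f.base z)))),
      (∀ a, e (algebraMap _ _ ((f.stalkMap z).hom a)) =
        algebraMap (MvPowerSeries (Fin m) (ResidueField (Y.presheaf.stalk (f.base z)))) _
          (eA (algebraMap _ _ a))) ∧
      ((stalkIdeal (vanishingIdeal ⟨closure (Set.range fun g : G => (ρX g).hom.base x),
          isClosed_closure⟩) z).map (algebraMap (X.presheaf.stalk z) (Cpl (X.presheaf.stalk z)))).map
        e.toRingHom =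
      (nodalCentre (MvPowerSeries (Fin m) (ResidueField (Y.presheaf.stalk (f.base z)))) c t).map
        (AlgebraicNodeRing.toNodeDeformationRing
          (MvPowerSeries (Fin m) (ResidueField (Y.presheaf.stalk (f.base z)))) (c * t ^ 2)).toRingHom := by
  classical
  haveI := Fintype.ofFinite G
  haveI := hss.locallyOfFiniteType
  -- `z` is a non-regular point, hence a point at which `f` is not smooth (3.1)
  have hOsing : ∀ y ∈ Set.range (fun g : G => (ρX g).hom.base x),
      ¬ IsRegularLocalRing (X.presheaf.stalk y) := by
    rintro _ ⟨g, rfl⟩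
    exact (mem_singularLocusCodimLE_of_iso (ρX g) hx).1
  have hzreg : ¬ IsRegularLocalRing (X.presheaf.stalk z) :=
    closure_subset_not_isRegularLocalRing f q hOsing hz
  have hns : ¬ ∃ U : X.Opens, z ∈ U ∧ Smooth (U.ι ≫ f) := by
    rintro ⟨U, hzU, hU⟩
    exact hzreg (isRegularLocalRing_of_smooth_of_isRegular hreg f hU hzU)
  -- formal coordinates at `z` (2.23 + 3.3)
  obtain ⟨m, r, w, ν, eA, e, -, -, -, -, heA, he⟩ :=
    centreFlat_exists_formalCoordinates q hreg hD f hss hqs hsm hns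
  haveI : IsDomain (MvPowerSeries (Fin m) (ResidueField (Y.presheaf.stalk (f.base z)))) :=
    NoZeroDivisors.to_isDomain _
  haveI : Module.Flat (X.presheaf.stalk z) (Cpl (X.presheaf.stalk z)) :=
    AdicCompletion.flat_of_isNoetherian _
  -- `𝒪_{X,z}` is a G-ring; the rebracketed model and its variables
  have hG : IsGRing (X.presheaf.stalk z) :=
    isGRing_stalk_of_polynomial Matsumura1987_32_polynomial_holds (f ≫ q) z
  have hτ : ∀ i, (e.trans (toFormalNodeRing (ResidueField (Y.presheaf.stalk (f.base z))) m ν))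
      (algebraMap (X.presheaf.stalk z) _ ((f.stalkMap z).hom (w i))) =
        Ideal.Quotient.mk _ (MvPowerSeries.X (Sum.inr i)) := by
    intro i
    rw [RingEquiv.trans_apply, he, heA, toFormalNodeRing_mk_C_X]
  -- 3.4 ¶2 for each translate `cl{x_g}` through `z`
  have hcomp : ∀ g : G, (ρX g).hom.base x ⤳ z → ∃ i, 2 ≤ ν i ∧
      ((stalkIdeal (vanishingIdeal ⟨closure {(ρX g).hom.base x}, isClosed_closure⟩) z).map
          (algebraMap (X.presheaf.stalk z) (Cpl (X.presheaf.stalk z)))).map e.toRingHom =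
        Ideal.span {Ideal.Quotient.mk _ (MvPowerSeries.X 0), Ideal.Quotient.mk _ (MvPowerSeries.X 1),
          Ideal.Quotient.mk _ (MvPowerSeries.C (MvPowerSeries.X i))} := by
    intro g hsp
    have hxg := mem_singularLocusCodimLE_of_iso (ρX g) hx
    rw [stalkIdeal_vanishingIdeal_closure hsp]
    set P : Ideal (X.presheaf.stalk z) := primeOfSpecializes hsp with hPdef
    letI algP : Algebra (X.presheaf.stalk z) (X.presheaf.stalk ((ρX g).hom.base x)) :=
      (X.presheaf.stalkSpecializes hsp).hom.toAlgebra
    haveI hlocP : IsLocalization.AtPrime (X.presheaf.stalk ((ρX g).hom.base x)) P :=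
      isLocalizationAtPrime_stalkSpecializes hsp
    let eP : Localization.AtPrime P ≃ₐ[X.presheaf.stalk z] X.presheaf.stalk ((ρX g).hom.base x) :=
      IsLocalization.algEquiv P.primeCompl (Localization.AtPrime P) (X.presheaf.stalk ((ρX g).hom.base x))
    have hPreg : ¬ IsRegularLocalRing (Localization.AtPrime P) := fun h =>
      hxg.1 (IsRegularLocalRing.of_ringEquiv eP.toRingEquiv)
    have hPdim : ringKrullDim (Localization.AtPrime P) ≤ 2 := by
      rw [ringKrullDim_eq_of_ringEquiv eP.toRingEquiv]
      exact hxg.2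
    obtain ⟨i₀, hi₀, -, hJ⟩ :=
      codimTwo_map_adicCompletion_eq_triplePrime hG
        (e.trans (toFormalNodeRing (ResidueField (Y.presheaf.stalk (f.base z))) m ν))
        (fun i => (f.stalkMap z).hom (w i)) hτ P hPreg hPdim
    refine ⟨i₀, hi₀, ?_⟩
    have h1 : ((P.map (algebraMap (X.presheaf.stalk z) (Cpl (X.presheaf.stalk z)))).map e.toRingHom).map
        (toFormalNodeRing (ResidueField (Y.presheaf.stalk (f.base z))) m ν).toRingHom =
          triplePrime (ResidueField (Y.presheaf.stalk (f.base z))) m ν i₀ := by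
      rw [Ideal.map_map, ← hJ]
      rfl
    rw [← map_span_triple_toFormalNodeRing (ResidueField (Y.presheaf.stalk (f.base z))) m ν i₀] at h1
    have h2 := congrArg (Ideal.comap
      (toFormalNodeRing (ResidueField (Y.presheaf.stalk (f.base z))) m ν).toRingHom) h1
    rwa [Ideal.comap_map_of_bijective
        (toFormalNodeRing (ResidueField (Y.presheaf.stalk (f.base z))) m ν).toRingHom
        (toFormalNodeRing (ResidueField (Y.presheaf.stalk (f.base z))) m ν).bijective,
      Ideal.comap_map_of_bijective
        (toFormalNodeRing (ResidueField (Y.presheaf.stalk (f.base z))) m ν).toRingHom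
        (toFormalNodeRing (ResidueField (Y.presheaf.stalk (f.base z))) m ν).bijective] at h2
  choose idx hidx hJidx using hcomp
  -- the set `S` of branches through `z`
  set S : Finset (Fin m) := Finset.univ.filter
    (fun j : Fin m => ∃ (g : G) (h : (ρX g).hom.base x ⤳ z), idx g h = j) with hS
  have hS2 : ∀ j ∈ S, 2 ≤ ν j := by
    intro j hj
    obtain ⟨g, h, rfl⟩ := (Finset.mem_filter.mp hj).2
    exact hidx g h
  -- the completed ideal of `Z` is `⋂_{j ∈ S} (u, v, T_j) = (u, v, ∏_{j ∈ S} T_j)`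
  have hI : ((stalkIdeal (vanishingIdeal ⟨closure (Set.range fun g : G => (ρX g).hom.base x),
      isClosed_closure⟩) z).map (algebraMap (X.presheaf.stalk z) (Cpl (X.presheaf.stalk z)))).map
        e.toRingHom =
      Ideal.span {Ideal.Quotient.mk _ (MvPowerSeries.X 0), Ideal.Quotient.mk _ (MvPowerSeries.X 1),
        Ideal.Quotient.mk _ (MvPowerSeries.C (∏ j ∈ S, MvPowerSeries.X j))} := by
    rw [← centreFlat_iInf_span_triple_X ν S hS2]
    rw [centreFlat_stalkIdeal_vanishingIdeal_closure_orbit]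
    rw [← Finset.inf_univ_eq_iInf]
    rw [Ideal.map_finset_inf_of_flat]
    rw [Finset.inf_univ_eq_iInf]
    have hmap := centreFlat_map_iInf_ringEquiv e (fun g : G =>
      (stalkIdeal (vanishingIdeal ⟨closure {(ρX g).hom.base x}, isClosed_closure⟩) z).map
        (algebraMap (X.presheaf.stalk z) (Cpl (X.presheaf.stalk z))))
    refine hmap.trans ?_
    apply le_antisymm
    · refine le_iInf₂ fun j hj => ?_
      obtain ⟨g, h, rfl⟩ := (Finset.mem_filter.mp hj).2
      exact (iInf_le _ g).trans (hJidx g h).le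
    · refine le_iInf fun g => ?_
      by_cases h : (ρX g).hom.base x ⤳ z
      · exact (iInf₂_le (idx g h) (Finset.mem_filter.mpr ⟨Finset.mem_univ _, g, h, rfl⟩)).trans
          (hJidx g h).ge
      · rw [centreFlat_stalkIdeal_vanishingIdeal_closure_eq_top h, Ideal.map_top, Ideal.map_top]
        exact le_top
  -- `∏ Tᵢ^{νᵢ} = c t²`
  set t : MvPowerSeries (Fin m) (ResidueField (Y.presheaf.stalk (f.base z))) :=
    ∏ j ∈ S, MvPowerSeries.X j with htdef
  set c : MvPowerSeries (Fin m) (ResidueField (Y.presheaf.stalk (f.base z))) :=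
    ∏ i, MvPowerSeries.X i ^ (if i ∈ S then ν i - 2 else ν i) with hcdef
  have hct : (RingEquiv.refl (MvPowerSeries (Fin m) (ResidueField (Y.presheaf.stalk (f.base z)))))
      (∏ i, MvPowerSeries.X i ^ ν i) = c * t ^ 2 := by
    rw [RingEquiv.refl_apply, hcdef, htdef]
    exact centreFlat_prod_pow_eq_mul_sq MvPowerSeries.X ν S hS2
  have ht0 : t ≠ 0 := Finset.prod_ne_zero_iff.mpr fun j _ =>
    (MvPowerSeries.prime_X' (ResidueField (Y.presheaf.stalk (f.base z))) j).ne_zero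
  let e₁ := e.trans (DeJong1996.NodeDeformationRing.congr (RingEquiv.refl _) _ _ hct)
  refine ⟨m, c, t, ht0, e₁, eA, fun a => ?_, ?_⟩
  · change DeJong1996.NodeDeformationRing.congr (RingEquiv.refl _) _ _ hct (e _) = _
    rw [he, congr_mk_C, RingEquiv.refl_apply, MvPowerSeries.c_eq_algebraMap]
    rfl
  · rw [map_nodalCentre_toNodeDeformationRing]
    change ((stalkIdeal _ z).map (algebraMap (X.presheaf.stalk z) (Cpl (X.presheaf.stalk z)))).map
      ((DeJong1996.NodeDeformationRing.congr (RingEquiv.refl _) _ _ hct).toRingHom.comp e.toRingHom) = _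
    rw [← Ideal.map_map, hI, Ideal.map_span, Set.image_insert_eq, Set.image_insert_eq,
      Set.image_singleton, RingEquiv.toRingHom_eq_coe, RingHom.coe_coe, congr_mk_X, congr_mk_X,
      congr_mk_C, RingEquiv.refl_apply]

end Summit.ResolutionOfSingularities.ResolutionOfSingularities.Theorems

end
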